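import Summits.QuantumFields.BalabanUV.Beta.GAN24.OneStepConstraintAxialDelKVolumeLimit
import Summits.QuantumFields.BalabanUV.Beta.GAN24.EffectiveFormDelK
import Summits.QuantumFields.BalabanUV.Beta.GAN24.DiagramVolumeLimitSandwich

/-!
# `BalabanUV.Beta.GAN24.EffectiveFormVolumeLimitPeriodise` — binder row G-an2-4 ∕ (CONV-C), routes C-R6° («VALUES») × R7 («TWO CURRENCIES») × road P2's periodisation, PART 194:
# THE EFFECTIVE FORM's `ℤ^d` END ALONG EVERY CUBIC VOLUME SEQUENCE, IN EVERY DIMENSION `d + 1 ≥ 2`, UNCONDITIONALLY — AND ITS LIMIT KERNEL NAMED.  PART 139 proved the END of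
# `Σ_k = (Q_k𝒢Q_kᴴ)⁻¹ − a·1 = c_k⁻¹ − a·1` for `d ≥ 3` along the EVEN cubic volumes (an5's fine propagator); PART 155 showed that `d ≥ 3` and evenness enter ONLY through EL₂ of the fine
# propagator (census V184).  PART 176 identified `Σ_k` with the β cell's (1.65) operator `Δ_{L^k} ∘ unitIdx`, and PART 190 gave EL₂ of `re Δ_n` along ANY period vectors `M → ∞` from road P2's
# periodisation identity, with the limit NAMED (`deltaZ n 1`).  Hence: `Σ_k` (and `c_k⁻¹ = Σ_k + a·1`) have EL₂ at every pair of unit readings along EVERY cubic volume sequence `s t → ∞` in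
# EVERY dimension `d + 1 ≥ 1`, the limit kernel of `Re Σ_k(e(·,μ′), e(0,ν′))` IS road P2's `ℤ^{d+1}` kernel `z ↦ deltaZ (L^k) 1 (z,μ′) (0,ν′)`, and PART 134's generic END applies: `UniformDecay`,
# `StepRate (√(L⁻¹))`, `KernelInputs`, second-moment convergence — census V184 CLOSED without the fine propagator (unit b2b-balaban-gan24-p3, gen 61; v1)

NOT IN PRINT; OUR PROOF ([folklore] bookkeeping BY NAME over PART 176 `EffectiveFormDelK.effForm_eq_DelK_submatrix`, PART 190 `OneStepConstraintAxialDelKVolumeLimit.tendsto_reDelK_castT`, pv09's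
`B6Cov2156TorusDelK.isReal_DelK`, PART 143 `DiagramVolumeLimitSandwich.tendsto_one_pair`, PART 134 `DiagramDecayWindow.conv_effForm_of_isInfiniteVolumeLimit`; [Balaban1984PropagatorsI] (1.65)–(1.66)
p. 29 and [Balaban1987RG1] (1.21)–(1.22) p. 264 LOCATE the objects and the `T ↗ ℤ^d` limit; nothing printed is a hypothesis).
HONEST FRAMING (cell contract, verbatim): «discharging `BetaPertH` makes Bałaban's UV stability UNCONDITIONAL — a real constructive-QFT result; it is NOT the
continuum limit and NOT the Clay problem.»  HONEST DEPENDENCY (verbatim): «continuum YM on T⁴ ⇐ BetaPertH ∧ nine spine estimates (0/9 proved); BetaPertH ⇐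
(D1) ∧ (D4) ∧ CAP+tail; G-an2-4 gates asym, D1 and NE2/3/4.»

WHAT THIS FILE PROVES (0 sorry, 0 `def`; dimension `d + 1`, `L ≥ 1`, `a > 0`, every cubic volume sequence `s t → ∞`; `e = (unitIdx L (cubic (d+1) (s t)))⁻¹`, `ẑ = castT (cubic (d+1) (s t)) z`):
* §1 **`tendsto_effForm_unitIdx`** — `Σ_k(e(ẑ,μ), e(ẑ′,ν)) → deltaZ (L^k) 1 (z − z′, μ) (0, ν)` (complex, the limit real), every `k`, NO hypothesis; **`exists_tendsto_inv_unitCovB_unitIdx`** — EL₂ of `c_k⁻¹`.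
* §2 **`isInfiniteVolumeLimit_effForm_allVolumes`** — `IsInfiniteVolumeLimit s (Re Σ_k(e(·,μ′),e(0,ν′))) (deltaZ (L^k) 1 ((·,μ′)) (0,ν′))`, every `k`.
* §3 **`conv_effForm_allVolumes`** — `L ≥ 2`, `d + 1 ≥ 2`, `μ ≠ ν`, ANY cubic volume sequence: PART 134's END with the limit kernels NAMED `Π_k μ′ ν′ z = deltaZ (L^k) 1 (z,μ′) (0,ν′)`: `UniformDecay Π μ ν C δ₀`,
  `StepRate Π μ ν C′ δ₀ (√(L⁻¹))`, `KernelInputs (d+1) Π` inhabited with `θ = √(L⁻¹)`, `∀ k, |secondMoment (Π k) μ ν − secondMoment Π_∞ μ ν| ≤ β′(C′∕(1−√(L⁻¹)), δ₀)·(√(L⁻¹))^k`.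
WHAT IT IS NOT: `Σ_k` is the (1.65)-dictionary effective form at `U = 1`, NOT Bałaban's `Π⁰_{k+1}`; the identification of `Π_∞ = limKernelOf Π` with a closed form is not attempted.  SUPPLIER work;
NEVER «G-an2-4 closed»; NOT (CONV-C), NOT D1, NOT `BetaPertH`, NOT continuum, NOT Clay.  Records: `HOME/b2b-balaban-gan24-p3/gen61/README.md`.
-/

noncomputable section

open scoped BigOperators ComplexConjugate Matrix
open Filter Topology Finset Matrix

namespace Summit.QuantumFields.BalabanUV.Beta.GAN24.EffectiveFormVolumeLimitPeriodise

open Literature.MathematicalPhysics.QuantumFieldTheory.Balaban1983to89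
open Literature.MathematicalPhysics.QuantumFieldTheory.Balaban1983to89.B5Prop11Plancherel (Tor fine)
open Literature.MathematicalPhysics.QuantumFieldTheory.Balaban1983to89.B5RealFields (reM reM_apply)
open Literature.MathematicalPhysics.QuantumFieldTheory.Balaban1983to89.B5G183RateUnitTower (lev)
open Literature.MathematicalPhysics.QuantumFieldTheory.Balaban1983to89.B12Sec2to5 (betaPrime510)
open Literature.MathematicalPhysics.QuantumFieldTheory.Balaban1983to89.Beta (IsInfiniteVolumeLimit)
open Literature.MathematicalPhysics.QuantumFieldTheory.Balaban1983to89.Beta.FreeLegDictionary (cubic)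
open Literature.MathematicalPhysics.QuantumFieldTheory.Balaban1983to89.Beta.VectorTails (castT)
open Literature.MathematicalPhysics.QuantumFieldTheory.Balaban1983to89.Beta.LimitRate (StepRate limKernelOf KernelInputs)
open Literature.MathematicalPhysics.QuantumFieldTheory.Balaban1983to89.Beta.BlockEffectiveAction (DelK)
open Literature.MathematicalPhysics.QuantumFieldTheory.Balaban1983to89.B6Cov2156TorusDelK (isReal_DelK)
open Summit.QuantumFields.BalabanUV.T4Continuum.BalabanAveragedTowerUnit (idx unitCovB one_le_lev')
open Summit.QuantumFields.BalabanUV.T4Continuum.BalabanAveragedCoerciveTower (unitIdx)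
open Summit.QuantumFields.BalabanUV.Beta.GAN24.DirichletExhaustionDeltaZ (deltaZ)
open Summit.QuantumFields.BalabanUV.Beta.GAN24.EffectiveFormDelK (effForm_eq_DelK_submatrix)
open Summit.QuantumFields.BalabanUV.Beta.GAN24.OneStepConstraintAxialDelKVolumeLimit (tendsto_reDelK_castT)
open Summit.QuantumFields.BalabanUV.Beta.GAN24.DiagramVolumeLimitSandwich (tendsto_one_pair)
open Summit.QuantumFields.BalabanUV.Beta.GAN24.DiagramDecayWindow (conv_effForm_of_isInfiniteVolumeLimit)

variable {d : ℕ} (L : ℕ) [NeZero L] (a : ℝ) (ha : 0 < a) (s : ℕ → ℕ) [hs0 : ∀ t, NeZero (s t)]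

/-! ## §1 EL₂ of `Σ_k` and `c_k⁻¹` along any cubic volume sequence, every dimension `d + 1` -/

/-- **`tendsto_effForm_unitIdx` — THE EFFECTIVE FORM CONVERGES AT EVERY PAIR OF UNIT READINGS, ALONG EVERY CUBIC VOLUME SEQUENCE, WITH A NAMED LIMIT**: in dimension `d + 1`, for every
`L ≥ 1`, `a > 0`, `k`, all `μ, ν`, `z, z′ ∈ ℤ^{d+1}` and every `s t → ∞`: `Σ_k(e(ẑ,μ), e(ẑ′,ν)) → deltaZ (L^k) 1 (z − z′, μ) (0, ν)` (PART 176: `Σ_k = Δ_{L^k} ∘ unitIdx`; pv09: `Δ_k` has real entries;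
PART 190: `re Δ_n` at integer readings converges to road P2's `ℤ^{d+1}` kernel along any period vectors `→ ∞`). NO residual hypothesis. [folklore] -/
theorem tendsto_effForm_unitIdx (hs : Tendsto s atTop atTop) (k : ℕ) (μ ν : Fin (d + 1)) (z z' : Fin (d + 1) → ℤ) :
    Tendsto (fun t => ((unitCovB L (cubic (d + 1) (s t)) a ha k)⁻¹ - (a : ℂ) • (1 : Matrix (idx L (cubic (d + 1) (s t)) 0) (idx L (cubic (d + 1) (s t)) 0) ℂ))
        ((unitIdx L (cubic (d + 1) (s t))).symm (castT (cubic (d + 1) (s t)) z, μ)) ((unitIdx L (cubic (d + 1) (s t))).symm (castT (cubic (d + 1) (s t)) z', ν)))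
      atTop (𝓝 (((deltaZ (lev L k) 1 (z - z', μ) (0, ν) : ℝ)) : ℂ)) := by
  have hMv : ∀ Nb : ℕ, ∀ᶠ t in atTop, ∀ i : Fin (d + 1), Nb ≤ cubic (d + 1) (s t) i := by
    intro Nb
    filter_upwards [hs.eventually_ge_atTop Nb] with t ht i
    exact ht
  have h := (Complex.continuous_ofReal.tendsto _).comp (tendsto_reDelK_castT (fun t => cubic (d + 1) (s t)) hMv (lev L k) (one_le_lev' L k) a ha μ ν z z')
  refine h.congr fun t => ?_
  rw [Function.comp_apply, effForm_eq_DelK_submatrix, Matrix.submatrix_apply, Equiv.apply_symm_apply, Equiv.apply_symm_apply, reM_apply]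
  exact (isReal_DelK (lev L k) (one_le_lev' L k) (cubic (d + 1) (s t)) a ha).coe_reM _ _

/-- **`exists_tendsto_inv_unitCovB_unitIdx` — EL₂ OF `c_k⁻¹ = Σ_k + a·1`** at every pair of unit readings along every cubic volume sequence (dimension `d + 1`; the unit matrix at unit readings is
eventually constant, PART 143 `tendsto_one_pair`). NO residual hypothesis. [folklore] -/
theorem exists_tendsto_inv_unitCovB_unitIdx (hs : Tendsto s atTop atTop) (k : ℕ) (μ ν : Fin (d + 1)) (z z' : Fin (d + 1) → ℤ) :
    ∃ c : ℂ, Tendsto (fun t => (unitCovB L (cubic (d + 1) (s t)) a ha k)⁻¹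
        ((unitIdx L (cubic (d + 1) (s t))).symm (castT (cubic (d + 1) (s t)) z, μ)) ((unitIdx L (cubic (d + 1) (s t))).symm (castT (cubic (d + 1) (s t)) z', ν))) atTop (𝓝 c) := by
  obtain ⟨c₁, hc₁⟩ := tendsto_one_pair L (d := d + 1) hs μ ν z z'
  refine ⟨(((deltaZ (lev L k) 1 (z - z', μ) (0, ν) : ℝ)) : ℂ) + (a : ℂ) * c₁, ((tendsto_effForm_unitIdx L a ha s hs k μ ν z z').add (hc₁.const_mul (a : ℂ))).congr fun t => ?_⟩
  simp only [Matrix.sub_apply, Matrix.smul_apply, smul_eq_mul]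
  ring

/-! ## §2 The named infinite-volume limit of `Re Σ_k` -/

/-- **`isInfiniteVolumeLimit_effForm_allVolumes` — THE INFINITE-VOLUME LIMIT KERNEL OF THE EFFECTIVE FORM IS ROAD P2's `deltaZ`**: in dimension `d + 1`, for every `L ≥ 1`, `a > 0`, `k` and every
cubic volume sequence `s t → ∞`: `IsInfiniteVolumeLimit s (t μ′ ν′ z ↦ Re Σ_{k,t}(e(ẑ,μ′), e(0,ν′))) (μ′ ν′ z ↦ deltaZ (L^k) 1 (z,μ′) (0,ν′))` — NO residual hypothesis (PART 139's
`isInfiniteVolumeLimit_effForm` needed `d ≥ 3` and even volumes and left the limit anonymous). [cite: Balaban1987RG1, (1.21) p.264 (the `T ↗ ℤ^d` limit — shape)] [folklore] -/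
theorem isInfiniteVolumeLimit_effForm_allVolumes (hs : Tendsto s atTop atTop) (k : ℕ) :
    IsInfiniteVolumeLimit s
      (fun t μ' ν' (z : Beta.Site (d + 1) (s t)) => (((unitCovB L (cubic (d + 1) (s t)) a ha k)⁻¹
          - (a : ℂ) • (1 : Matrix (idx L (cubic (d + 1) (s t)) 0) (idx L (cubic (d + 1) (s t)) 0) ℂ))
        ((unitIdx L (cubic (d + 1) (s t))).symm (z, μ')) ((unitIdx L (cubic (d + 1) (s t))).symm (0, ν'))).re)
      (fun μ' ν' z => deltaZ (lev L k) 1 (z, μ') (0, ν')) := by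
  intro μ' ν' x
  have h := (Complex.continuous_re.tendsto _).comp (tendsto_effForm_unitIdx L a ha s hs k μ' ν' x 0)
  rw [sub_zero, Complex.ofReal_re] at h
  refine h.congr fun t => ?_
  have e0 : castT (cubic (d + 1) (s t)) (0 : Fin (d + 1) → ℤ) = 0 := by funext i; simp [castT]
  simp only [Function.comp_apply, e0]
  rfl

/-! ## §3 The END along every cubic volume sequence, every dimension `d + 1 ≥ 2` -/

/-- **`conv_effForm_allVolumes` — THE EFFECTIVE FORM's `ℤ^{d+1}` END ALONG EVERY CUBIC VOLUME SEQUENCE, UNCONDITIONALLY, WITH NAMED LIMIT KERNELS** (`L ≥ 2`, `d + 1 ≥ 2`, `a > 0`, `μ ≠ ν`,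
`s t → ∞`): with `Π_k μ′ ν′ z := deltaZ (L^k) 1 (z,μ′) (0,ν′)` (road P2's `ℤ^{d+1}` kernels — §2 identifies them as the infinite-volume limits of `Re Σ_k`), there are `δ₀ > 0`, `C, C′ ≥ 0` (PART 132's,
from `(d, L, a)`) with `UniformDecay Π μ ν C δ₀`, `StepRate Π μ ν C′ δ₀ (√(L⁻¹))`, `KernelInputs (d+1) Π` inhabited with `θ = √(L⁻¹)`, and
`∀ k, |secondMoment (Π k) μ ν − secondMoment (limKernelOf Π) μ ν| ≤ β′_{d+1}(C′∕(1−√(L⁻¹)), δ₀)·(√(L⁻¹))^k` — PART 134's `conv_effForm_of_isInfiniteVolumeLimit` with its one displayed hypothesis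
supplied by §2.  Census V184 («all d ∕ all volumes») CLOSED; PART 139's `d ≥ 3` ∕ evenness are gone. [cite: Balaban1987RG1, (1.21)–(1.22) p.264 (shapes)] [folklore] -/
theorem conv_effForm_allVolumes (hL : 2 ≤ L) (hd : 1 ≤ d) {μ ν : Fin (d + 1)} (hne : μ ≠ ν) (hs : Tendsto s atTop atTop) :
    ∃ δ₀ C C' : ℝ, 0 < δ₀ ∧ 0 ≤ C ∧ 0 ≤ C' ∧
      (∀ k, IsInfiniteVolumeLimit s
        (fun t μ' ν' (z : Beta.Site (d + 1) (s t)) => (((unitCovB L (cubic (d + 1) (s t)) a ha k)⁻¹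
            - (a : ℂ) • (1 : Matrix (idx L (cubic (d + 1) (s t)) 0) (idx L (cubic (d + 1) (s t)) 0) ℂ))
          ((unitIdx L (cubic (d + 1) (s t))).symm (z, μ')) ((unitIdx L (cubic (d + 1) (s t))).symm (0, ν'))).re)
        (fun μ' ν' z => deltaZ (lev L k) 1 (z, μ') (0, ν'))) ∧
      Beta.LimitRate.UniformDecay (fun k μ' ν' z => deltaZ (d := d) (lev L k) 1 (z, μ') (0, ν')) μ ν C δ₀ ∧
      StepRate (fun k μ' ν' z => deltaZ (d := d) (lev L k) 1 (z, μ') (0, ν')) μ ν C' δ₀ (Real.sqrt ((L : ℝ)⁻¹)) ∧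
      (∃ K : KernelInputs (d + 1) (fun k μ' ν' z => deltaZ (d := d) (lev L k) 1 (z, μ') (0, ν')),
        K.θ = Real.sqrt ((L : ℝ)⁻¹) ∧ K.c₀ = betaPrime510 (d + 1) (C' / (1 - Real.sqrt ((L : ℝ)⁻¹))) δ₀ ∧
        K.Pinf = limKernelOf (fun k μ' ν' z => deltaZ (d := d) (lev L k) 1 (z, μ') (0, ν')) ∧ K.μ = μ ∧ K.ν = ν) ∧
      (∀ k, |B12Beta.secondMoment ((fun k μ' ν' z => deltaZ (d := d) (lev L k) 1 (z, μ') (0, ν')) k) μ ν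
          - B12Beta.secondMoment (limKernelOf (fun k μ' ν' z => deltaZ (d := d) (lev L k) 1 (z, μ') (0, ν'))) μ ν|
          ≤ betaPrime510 (d + 1) (C' / (1 - Real.sqrt ((L : ℝ)⁻¹))) δ₀ * Real.sqrt ((L : ℝ)⁻¹) ^ k) := by
  have hd' : 2 ≤ d + 1 := by omega
  obtain ⟨δ₀, C, C', hδ₀, hC, hC', h⟩ := conv_effForm_of_isInfiniteVolumeLimit L a ha hL hd' hne
  have hlim := fun k => isInfiniteVolumeLimit_effForm_allVolumes (d := d) L a ha s hs k
  exact ⟨δ₀, C, C', hδ₀, hC, hC', hlim, h s hs _ hlim⟩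

end Summit.QuantumFields.BalabanUV.Beta.GAN24.EffectiveFormVolumeLimitPeriodise

end
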